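import Summits.AnomalousDissipation.AnomalousDissipation.Theorems.SolenoidalFractalHomogenisationLagrangianStepVmodCorrectedTestDeriv
import Literature.Analysis.FluidPDE.PassiveVectorTensorDistortedDuality
import Literature.Analysis.FunctionSpaces.TorusFourierModes
import Literature.Analysis.FluidPDE.LipschitzBiotSavart
import HarnessLib

/-!
# K1L_D (stmt-AnomalousDissipation-27980), (ℓ3-A) road A, (S1b): POINTWISE bound of the distorted generator applied to the corrected steady
# test `J•ζ` — `‖J'•ζ + (b·∇)(J•ζ) + 𝓛^{G,*}_{𝔸'}(J•ζ)‖(x) ≤ a₀‖ζ x‖ + a₁ Σ_c‖∂_cζ x‖ + a₂ Σ_{e,c}‖∂_e∂_cζ x‖`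
(helper; `--supports 27980 --as helper`; prover ad-k1loc-p3 g11; RULING D28-18 (5): the `hN` of (D-GEN-J) in the L²-form needs the test
factors POINTWISE — this is the pointwise layer; the L² layer squares and integrates it.)

* §1 vectors/matrices (`‖v‖ ≤ Σ|vᵢ|` is `NewtonPotentialHolder.norm_le_sum_abs`): `sum_abs_le_three_norm`, `norm_distort_le_pt` (`‖(M•ζ)(x)‖ ≤ 9·C·‖ζ x‖`);
* §2 conjugated tensor: `abs_conj_entry_le` (`|𝔸^{G}| ≤ 9·C·A·C`), `abs_partialDeriv_conj_entry_le` (`|∂𝔸^{G}| ≤ 9(CAB + BAC)`),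
  `abs_partialDeriv_conj_mul_le_pt` (pointwise twin of `abs_partialDeriv_conj_mul_le`, p723392);
* §3 `abs_viscAdjVar_apply_le_pt`, `norm_viscAdjVar_le_pt` — `‖𝓛^{G,*}_{𝔸'}Ψ (x)‖ ≤ 3(27·CAC·Σ_{c,e}‖∂_e∂_cΨ x‖ + 81(CAB+BAC)Σ_c‖∂_cΨ x‖)`;
* §4 `Ψ = J•ζ`: `norm_partialDeriv_distort_le_pt`, `norm_partialDeriv₂_distort_le_pt`, **`norm_correctedGenerator_le_pt`** (explicit `a₀,a₁,a₂` in
  `|G| ≤ C`, `|∂G| ≤ B`, `|𝔸'| ≤ A`, `|J| ≤ C₀`, `|∂J| ≤ C₁`, `|∂²J| ≤ C₂`, `|J'| ≤ CJ'`, `‖b‖ ≤ Bb`).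
`sorry`-free; NOT a proof of any block, of K1L_D or of AD; rung F-D1.A0.
-/

set_option linter.dupNamespace false

noncomputable section

namespace Summit.AnomalousDissipation.AnomalousDissipation.Theorems.SolenoidalFractalHomogenisation.LagrangianStep.VmodDist

open Literature.Analysis Literature.Analysis.FluidPDE Literature.Analysis.FunctionSpaces
open Set

/-! ## §1 Vectors and matrices -/

/-- `Σᵢ |vᵢ| ≤ 3‖v‖` in `ℝ³`. -/
theorem sum_abs_le_three_norm (w : EuclideanSpace ℝ (Fin 3)) : ∑ i, |w i| ≤ 3 * ‖w‖ := by
  calc ∑ i, |w i| ≤ ∑ _i : Fin 3, ‖w‖ := Finset.sum_le_sum fun i _ => abs_apply_le_norm w i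
    _ = 3 * ‖w‖ := by simp only [Finset.sum_const, Finset.card_univ, Fintype.card_fin, nsmul_eq_mul]; push_cast; ring

/-- **`‖(M•ζ)(x)‖ ≤ 9·C·‖ζ x‖`** for a matrix field with `|M x a c| ≤ C`. -/
theorem norm_distort_le_pt {M : UnitAddTorus (Fin 3) → Matrix (Fin 3) (Fin 3) ℝ} {ζ : VF} {C : ℝ} (hC0 : 0 ≤ C)
    (hM : ∀ y a c, |M y a c| ≤ C) (x : UnitAddTorus (Fin 3)) : ‖Torus.distort M ζ x‖ ≤ 9 * C * ‖ζ x‖ := by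
  refine (NewtonPotentialHolder.norm_le_sum_abs _).trans ?_
  have : ∀ a ∈ (Finset.univ : Finset (Fin 3)), |Torus.distort M ζ x a| ≤ 3 * (C * ‖ζ x‖) := fun a _ => by
    rw [Torus.distort_apply_eq_sum]
    refine (Finset.abs_sum_le_sum_abs _ _).trans ?_
    have : ∀ c ∈ (Finset.univ : Finset (Fin 3)), |M x a c * ζ x c| ≤ C * ‖ζ x‖ := fun c _ => by
      rw [abs_mul]; exact mul_le_mul (hM x a c) (abs_apply_le_norm _ c) (abs_nonneg _) hC0
    refine (Finset.sum_le_sum this).trans ?_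
    simp only [Finset.sum_const, Finset.card_univ, Fintype.card_fin, nsmul_eq_mul]; push_cast; linarith
  refine (Finset.sum_le_sum this).trans ?_
  simp only [Finset.sum_const, Finset.card_univ, Fintype.card_fin, nsmul_eq_mul]; push_cast; linarith

/-! ## §2 The conjugated tensor and one summand of `viscAdjVar`, pointwise in the test -/

variable {Gs : UnitAddTorus (Fin 3) → Matrix (Fin 3) (Fin 3) ℝ}

/-- `|𝔸^{G}(x)_{icje}| ≤ 9·C·A₀·C` for `|G| ≤ C`, `|𝔹₀| ≤ A₀`. -/
theorem abs_conj_entry_le (𝔹₀ : Torus.Visc4 (Fin 3)) {C A₀ : ℝ} (hC0 : 0 ≤ C) (hA0 : 0 ≤ A₀)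
    (hC : ∀ y i j, |Gs y i j| ≤ C) (hA : ∀ i a j b', |𝔹₀ i a j b'| ≤ A₀) (i c j e : Fin 3) (x : UnitAddTorus (Fin 3)) :
    |Torus.Visc4.conj (Gs x) 𝔹₀ i c j e| ≤ 9 * (C * A₀ * C) := by
  rw [Torus.Visc4.conj_apply]
  refine (Finset.abs_sum_le_sum_abs _ _).trans ?_
  have : ∀ a ∈ (Finset.univ : Finset (Fin 3)), |∑ b', Gs x c a * 𝔹₀ i a j b' * Gs x e b'| ≤ 3 * (C * A₀ * C) := fun a _ => by
    refine (Finset.abs_sum_le_sum_abs _ _).trans ?_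
    have : ∀ b' ∈ (Finset.univ : Finset (Fin 3)), |Gs x c a * 𝔹₀ i a j b' * Gs x e b'| ≤ C * A₀ * C := fun b' _ => by
      rw [abs_mul, abs_mul]
      exact mul_le_mul (mul_le_mul (hC x c a) (hA i a j b') (abs_nonneg _) hC0) (hC x e b') (abs_nonneg _) (by positivity)
    refine (Finset.sum_le_sum this).trans ?_
    simp only [Finset.sum_const, Finset.card_univ, Fintype.card_fin, nsmul_eq_mul]; push_cast; linarith
  refine (Finset.sum_le_sum this).trans ?_
  simp only [Finset.sum_const, Finset.card_univ, Fintype.card_fin, nsmul_eq_mul]; push_cast; linarith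

/-- `|∂_e' 𝔸^{G}(·)_{icje} (x)| ≤ 9·(C·A₀·B + B·A₀·C)` for `|G| ≤ C`, `|∂G| ≤ B`, `|𝔹₀| ≤ A₀`. -/
theorem abs_partialDeriv_conj_entry_le (hG1 : ∀ i j, Torus.IsContDiff 1 (fun y => Gs y i j)) (𝔹₀ : Torus.Visc4 (Fin 3))
    {C B A₀ : ℝ} (hC0 : 0 ≤ C) (hB0 : 0 ≤ B) (hA0 : 0 ≤ A₀)
    (hC : ∀ y i j, |Gs y i j| ≤ C) (hB : ∀ y i j e', |Torus.partialDeriv e' (fun y => Gs y i j) y| ≤ B)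
    (hA : ∀ i a j b', |𝔹₀ i a j b'| ≤ A₀) (i c j e e' : Fin 3) (x : UnitAddTorus (Fin 3)) :
    |Torus.partialDeriv e' (fun y => Torus.Visc4.conj (Gs y) 𝔹₀ i c j e) x| ≤ 9 * (C * A₀ * B + B * A₀ * C) := by
  have hprod : ∀ a b', Torus.IsContDiff 1 (fun y => Gs y c a * 𝔹₀ i a j b' * Gs y e b') := fun a b' => by
    unfold Torus.IsContDiff; exact ((hG1 c a).mul contDiff_const).mul (hG1 e b')
  have hca : ∀ a b', Torus.IsContDiff 1 (fun y => Gs y c a * 𝔹₀ i a j b') := fun a b' => by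
    unfold Torus.IsContDiff; exact (hG1 c a).mul contDiff_const
  have e1 : Torus.partialDeriv e' (fun y => Torus.Visc4.conj (Gs y) 𝔹₀ i c j e) x =
      ∑ a, ∑ b', ((Gs x c a * 𝔹₀ i a j b') * Torus.partialDeriv e' (fun y => Gs y e b') x +
        (Torus.partialDeriv e' (fun y => Gs y c a) x * 𝔹₀ i a j b') * Gs x e b') := by
    rw [show (fun y => Torus.Visc4.conj (Gs y) 𝔹₀ i c j e) = fun y => ∑ a, ∑ b', Gs y c a * 𝔹₀ i a j b' * Gs y e b' from
      funext fun y => Torus.Visc4.conj_apply _ _ _ _ _ _]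
    rw [Torus.partialDeriv_finset_sum _ (fun a _ => ?_)]
    · refine Finset.sum_congr rfl fun a _ => ?_
      rw [Torus.partialDeriv_finset_sum _ (fun b' _ => hprod a b')]
      refine Finset.sum_congr rfl fun b' _ => ?_
      rw [Torus.partialDeriv_mul (hca a b') (hG1 e b'), Torus.partialDeriv_mul (hG1 c a) (Torus.isContDiff_const _)]
      have h0 : Torus.partialDeriv e' (fun _ : UnitAddTorus (Fin 3) => 𝔹₀ i a j b') x = 0 := by
        simp [Torus.partialDeriv, Torus.lineDeriv]
      rw [h0, mul_zero, zero_add]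
    · unfold Torus.IsContDiff
      exact ContDiff.sum (s := Finset.univ) fun b' _ => hprod a b'
  rw [e1]
  refine (Finset.abs_sum_le_sum_abs _ _).trans ?_
  have : ∀ a ∈ (Finset.univ : Finset (Fin 3)), |∑ b', ((Gs x c a * 𝔹₀ i a j b') * Torus.partialDeriv e' (fun y => Gs y e b') x +
      (Torus.partialDeriv e' (fun y => Gs y c a) x * 𝔹₀ i a j b') * Gs x e b')| ≤ 3 * (C * A₀ * B + B * A₀ * C) := fun a _ => by
    refine (Finset.abs_sum_le_sum_abs _ _).trans ?_
    have : ∀ b' ∈ (Finset.univ : Finset (Fin 3)), |(Gs x c a * 𝔹₀ i a j b') * Torus.partialDeriv e' (fun y => Gs y e b') x +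
        (Torus.partialDeriv e' (fun y => Gs y c a) x * 𝔹₀ i a j b') * Gs x e b'| ≤ C * A₀ * B + B * A₀ * C := fun b' _ => by
      refine (abs_add_le _ _).trans (add_le_add ?_ ?_)
      · rw [abs_mul, abs_mul]
        exact mul_le_mul (mul_le_mul (hC x c a) (hA i a j b') (abs_nonneg _) hC0) (hB x e b' e') (abs_nonneg _) (by positivity)
      · rw [abs_mul, abs_mul]
        exact mul_le_mul (mul_le_mul (hB x c a e') (hA i a j b') (abs_nonneg _) hB0) (hC x e b') (abs_nonneg _) (by positivity)
    refine (Finset.sum_le_sum this).trans ?_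
    simp only [Finset.sum_const, Finset.card_univ, Fintype.card_fin, nsmul_eq_mul]; push_cast; linarith
  refine (Finset.sum_le_sum this).trans ?_
  simp only [Finset.sum_const, Finset.card_univ, Fintype.card_fin, nsmul_eq_mul]; push_cast; linarith

/-- **Pointwise twin of `abs_partialDeriv_conj_mul_le`**: `|∂_e(𝔸^{G}_{icje}·(∂_cΨ)_i)(x)| ≤ 9CA₀C·|(∂_e∂_cΨ)(x)_i| + 9(CA₀B+BA₀C)·|(∂_cΨ)(x)_i|`. -/
theorem abs_partialDeriv_conj_mul_le_pt (hG1 : ∀ i j, Torus.IsContDiff 1 (fun y => Gs y i j)) {Ψ : VF} (hΨ : Torus.IsSmooth Ψ)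
    (𝔹₀ : Torus.Visc4 (Fin 3)) {C B A₀ : ℝ} (hC0 : 0 ≤ C) (hB0 : 0 ≤ B) (hA0 : 0 ≤ A₀)
    (hC : ∀ y i j, |Gs y i j| ≤ C) (hB : ∀ y i j e', |Torus.partialDeriv e' (fun y => Gs y i j) y| ≤ B)
    (hA : ∀ i a j b', |𝔹₀ i a j b'| ≤ A₀) (i c j e : Fin 3) (x : UnitAddTorus (Fin 3)) :
    |Torus.partialDeriv e (fun y => Torus.Visc4.conj (Gs y) 𝔹₀ i c j e * (Torus.partialDeriv c Ψ y) i) x|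
      ≤ 9 * (C * A₀ * C) * |(Torus.partialDeriv e (Torus.partialDeriv c Ψ) x) i|
        + 9 * (C * A₀ * B + B * A₀ * C) * |(Torus.partialDeriv c Ψ x) i| := by
  have h𝔹1 : Torus.IsContDiff 1 (fun y => Torus.Visc4.conj (Gs y) 𝔹₀ i c j e) := Torus.isContDiff_one_conj_entry hG1 𝔹₀ i c j e
  have hΨ1 : Torus.IsContDiff 1 (Torus.partialDeriv c Ψ) := (hΨ.partialDeriv c).isContDiff (by simp)
  have hΨ1i : Torus.IsContDiff 1 (fun y => (Torus.partialDeriv c Ψ y) i) := ((hΨ.partialDeriv c).apply i).isContDiff (by simp)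
  rw [Torus.partialDeriv_mul h𝔹1 hΨ1i, Torus.partialDeriv_apply_coord hΨ1]
  refine (abs_add_le _ _).trans (add_le_add ?_ ?_)
  · rw [abs_mul]
    exact mul_le_mul_of_nonneg_right (abs_conj_entry_le 𝔹₀ hC0 hA0 hC hA i c j e x) (abs_nonneg _)
  · rw [abs_mul]
    exact mul_le_mul_of_nonneg_right (abs_partialDeriv_conj_entry_le hG1 𝔹₀ hC0 hB0 hA0 hC hB hA i c j e e x) (abs_nonneg _)

/-! ## §3 The distorted adjoint viscous operator, pointwise in the test -/

/-- **`|(𝓛^{G,*}_{𝔹₀}Ψ)(x)_l| ≤ 27·CA₀C·Σ_cΣ_e‖∂_e∂_cΨ x‖ + 81·(CA₀B+BA₀C)·Σ_c‖∂_cΨ x‖`.** -/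
theorem abs_viscAdjVar_apply_le_pt (hG1 : ∀ i j, Torus.IsContDiff 1 (fun y => Gs y i j)) {Ψ : VF} (hΨ : Torus.IsSmooth Ψ)
    (𝔹₀ : Torus.Visc4 (Fin 3)) {C B A₀ : ℝ} (hC0 : 0 ≤ C) (hB0 : 0 ≤ B) (hA0 : 0 ≤ A₀)
    (hC : ∀ y i j, |Gs y i j| ≤ C) (hB : ∀ y i j e', |Torus.partialDeriv e' (fun y => Gs y i j) y| ≤ B)
    (hA : ∀ i a j b', |𝔹₀ i a j b'| ≤ A₀) (x : UnitAddTorus (Fin 3)) (l : Fin 3) :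
    |Torus.viscAdjVar (fun y => Torus.Visc4.conj (Gs y) 𝔹₀) Ψ x l|
      ≤ 27 * (C * A₀ * C) * ∑ c, ∑ e, ‖Torus.partialDeriv e (Torus.partialDeriv c Ψ) x‖
        + 81 * (C * A₀ * B + B * A₀ * C) * ∑ c, ‖Torus.partialDeriv c Ψ x‖ := by
  rw [Torus.viscAdjVar_apply]
  have hK1 : 0 ≤ 9 * (C * A₀ * C) := by positivity
  have hK2 : 0 ≤ 9 * (C * A₀ * B + B * A₀ * C) := by positivity
  -- sum over `i` of the summand bound: `Σ_i |v_i| ≤ 3‖v‖`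
  have hce : ∀ c e, |∑ i, Torus.partialDeriv e (fun y => Torus.Visc4.conj (Gs y) 𝔹₀ i c l e * (Torus.partialDeriv c Ψ y) i) x|
      ≤ 27 * (C * A₀ * C) * ‖Torus.partialDeriv e (Torus.partialDeriv c Ψ) x‖
        + 27 * (C * A₀ * B + B * A₀ * C) * ‖Torus.partialDeriv c Ψ x‖ := fun c e => by
    refine (Finset.abs_sum_le_sum_abs _ _).trans ?_
    calc ∑ i, |Torus.partialDeriv e (fun y => Torus.Visc4.conj (Gs y) 𝔹₀ i c l e * (Torus.partialDeriv c Ψ y) i) x|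
        ≤ ∑ i, (9 * (C * A₀ * C) * |(Torus.partialDeriv e (Torus.partialDeriv c Ψ) x) i|
            + 9 * (C * A₀ * B + B * A₀ * C) * |(Torus.partialDeriv c Ψ x) i|) :=
          Finset.sum_le_sum fun i _ => abs_partialDeriv_conj_mul_le_pt hG1 hΨ 𝔹₀ hC0 hB0 hA0 hC hB hA i c l e x
      _ = 9 * (C * A₀ * C) * ∑ i, |(Torus.partialDeriv e (Torus.partialDeriv c Ψ) x) i|
            + 9 * (C * A₀ * B + B * A₀ * C) * ∑ i, |(Torus.partialDeriv c Ψ x) i| := by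
          rw [Finset.sum_add_distrib, Finset.mul_sum, Finset.mul_sum]
      _ ≤ 9 * (C * A₀ * C) * (3 * ‖Torus.partialDeriv e (Torus.partialDeriv c Ψ) x‖)
            + 9 * (C * A₀ * B + B * A₀ * C) * (3 * ‖Torus.partialDeriv c Ψ x‖) :=
          add_le_add (mul_le_mul_of_nonneg_left (sum_abs_le_three_norm _) hK1) (mul_le_mul_of_nonneg_left (sum_abs_le_three_norm _) hK2)
      _ = _ := by ring
  -- reorder the sums `Σ_i Σ_c Σ_e` as `Σ_c Σ_e Σ_i`
  have hre : ∑ i, ∑ c, ∑ e, Torus.partialDeriv e (fun y => Torus.Visc4.conj (Gs y) 𝔹₀ i c l e * (Torus.partialDeriv c Ψ y) i) x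
      = ∑ c, ∑ e, ∑ i, Torus.partialDeriv e (fun y => Torus.Visc4.conj (Gs y) 𝔹₀ i c l e * (Torus.partialDeriv c Ψ y) i) x := by
    rw [Finset.sum_comm]
    exact Finset.sum_congr rfl fun c _ => Finset.sum_comm
  rw [hre]
  refine (Finset.abs_sum_le_sum_abs _ _).trans ?_
  calc ∑ c, |∑ e, ∑ i, Torus.partialDeriv e (fun y => Torus.Visc4.conj (Gs y) 𝔹₀ i c l e * (Torus.partialDeriv c Ψ y) i) x|
      ≤ ∑ c, ∑ e, (27 * (C * A₀ * C) * ‖Torus.partialDeriv e (Torus.partialDeriv c Ψ) x‖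
          + 27 * (C * A₀ * B + B * A₀ * C) * ‖Torus.partialDeriv c Ψ x‖) :=
        Finset.sum_le_sum fun c _ => (Finset.abs_sum_le_sum_abs _ _).trans (Finset.sum_le_sum fun e _ => hce c e)
    _ = 27 * (C * A₀ * C) * ∑ c, ∑ e, ‖Torus.partialDeriv e (Torus.partialDeriv c Ψ) x‖
          + 81 * (C * A₀ * B + B * A₀ * C) * ∑ c, ‖Torus.partialDeriv c Ψ x‖ := by
        simp only [Finset.sum_add_distrib, Finset.sum_const, Finset.card_univ, Fintype.card_fin, nsmul_eq_mul, Finset.mul_sum]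
        push_cast
        ring

/-- **`‖(𝓛^{G,*}_{𝔹₀}Ψ)(x)‖ ≤ 3·(27·CA₀C·Σ_cΣ_e‖∂_e∂_cΨ x‖ + 81(CA₀B+BA₀C)Σ_c‖∂_cΨ x‖)`.** -/
theorem norm_viscAdjVar_le_pt (hG1 : ∀ i j, Torus.IsContDiff 1 (fun y => Gs y i j)) {Ψ : VF} (hΨ : Torus.IsSmooth Ψ)
    (𝔹₀ : Torus.Visc4 (Fin 3)) {C B A₀ : ℝ} (hC0 : 0 ≤ C) (hB0 : 0 ≤ B) (hA0 : 0 ≤ A₀)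
    (hC : ∀ y i j, |Gs y i j| ≤ C) (hB : ∀ y i j e', |Torus.partialDeriv e' (fun y => Gs y i j) y| ≤ B)
    (hA : ∀ i a j b', |𝔹₀ i a j b'| ≤ A₀) (x : UnitAddTorus (Fin 3)) :
    ‖Torus.viscAdjVar (fun y => Torus.Visc4.conj (Gs y) 𝔹₀) Ψ x‖
      ≤ 3 * (27 * (C * A₀ * C) * ∑ c, ∑ e, ‖Torus.partialDeriv e (Torus.partialDeriv c Ψ) x‖
        + 81 * (C * A₀ * B + B * A₀ * C) * ∑ c, ‖Torus.partialDeriv c Ψ x‖) := by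
  refine (NewtonPotentialHolder.norm_le_sum_abs _).trans ?_
  calc ∑ l, |Torus.viscAdjVar (fun y => Torus.Visc4.conj (Gs y) 𝔹₀) Ψ x l|
      ≤ ∑ _l : Fin 3, (27 * (C * A₀ * C) * ∑ c, ∑ e, ‖Torus.partialDeriv e (Torus.partialDeriv c Ψ) x‖
        + 81 * (C * A₀ * B + B * A₀ * C) * ∑ c, ‖Torus.partialDeriv c Ψ x‖) :=
        Finset.sum_le_sum fun l _ => abs_viscAdjVar_apply_le_pt hG1 hΨ 𝔹₀ hC0 hB0 hA0 hC hB hA x l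
    _ = _ := by simp only [Finset.sum_const, Finset.card_univ, Fintype.card_fin, nsmul_eq_mul]; push_cast; ring

/-! ## §4 The corrected test `Ψ = J•ζ`: bounds in the factors `ζ(x), ∂ζ(x), ∂²ζ(x)` -/

variable {Jt : UnitAddTorus (Fin 3) → Matrix (Fin 3) (Fin 3) ℝ} {ζ : VF}

/-- `‖∂_c(J•ζ)(x)‖ ≤ 9·(C₁‖ζ x‖ + C₀‖∂_cζ x‖)`. -/
theorem norm_partialDeriv_distort_le_pt (hJ : ∀ a m, Torus.IsSmooth (fun y => Jt y a m)) (hζ : Torus.IsSmooth ζ)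
    {C₀ C₁ : ℝ} (hC0 : 0 ≤ C₀) (hC1 : 0 ≤ C₁) (hJ0 : ∀ y a m, |Jt y a m| ≤ C₀) (hJ1 : ∀ y a m c, |Torus.partialDeriv c (fun y => Jt y a m) y| ≤ C₁)
    (c : Fin 3) (x : UnitAddTorus (Fin 3)) :
    ‖Torus.partialDeriv c (Torus.distort Jt ζ) x‖ ≤ 9 * (C₁ * ‖ζ x‖ + C₀ * ‖Torus.partialDeriv c ζ x‖) := by
  refine (NewtonPotentialHolder.norm_le_sum_abs _).trans ?_
  calc ∑ a, |(Torus.partialDeriv c (Torus.distort Jt ζ) x) a| ≤ ∑ _a : Fin 3, 3 * (C₁ * ‖ζ x‖ + C₀ * ‖Torus.partialDeriv c ζ x‖) :=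
        Finset.sum_le_sum fun a _ => abs_partialDeriv_distort_apply_le hJ hζ hC0 hC1 hJ0 hJ1 c x a
    _ = _ := by simp only [Finset.sum_const, Finset.card_univ, Fintype.card_fin, nsmul_eq_mul]; push_cast; ring

/-- `‖∂_e∂_c(J•ζ)(x)‖ ≤ 9·(C₂‖ζ x‖ + C₁(‖∂_eζ x‖ + ‖∂_cζ x‖) + C₀‖∂_e∂_cζ x‖)`. -/
theorem norm_partialDeriv₂_distort_le_pt (hJ : ∀ a m, Torus.IsSmooth (fun y => Jt y a m)) (hζ : Torus.IsSmooth ζ)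
    {C₀ C₁ C₂ : ℝ} (hC0 : 0 ≤ C₀) (hC1 : 0 ≤ C₁) (hC2 : 0 ≤ C₂) (hJ0 : ∀ y a m, |Jt y a m| ≤ C₀)
    (hJ1 : ∀ y a m c, |Torus.partialDeriv c (fun y => Jt y a m) y| ≤ C₁)
    (hJ2 : ∀ y a m c e, |Torus.partialDeriv e (Torus.partialDeriv c (fun y => Jt y a m)) y| ≤ C₂)
    (e c : Fin 3) (x : UnitAddTorus (Fin 3)) :
    ‖Torus.partialDeriv e (Torus.partialDeriv c (Torus.distort Jt ζ)) x‖
      ≤ 9 * (C₂ * ‖ζ x‖ + C₁ * (‖Torus.partialDeriv e ζ x‖ + ‖Torus.partialDeriv c ζ x‖)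
          + C₀ * ‖Torus.partialDeriv e (Torus.partialDeriv c ζ) x‖) := by
  refine (NewtonPotentialHolder.norm_le_sum_abs _).trans ?_
  calc ∑ a, |(Torus.partialDeriv e (Torus.partialDeriv c (Torus.distort Jt ζ)) x) a|
      ≤ ∑ _a : Fin 3, 3 * (C₂ * ‖ζ x‖ + C₁ * (‖Torus.partialDeriv e ζ x‖ + ‖Torus.partialDeriv c ζ x‖)
          + C₀ * ‖Torus.partialDeriv e (Torus.partialDeriv c ζ) x‖) :=
        Finset.sum_le_sum fun a _ => abs_partialDeriv₂_distort_apply_le hJ hζ hC0 hC1 hC2 hJ0 hJ1 hJ2 e c x a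
    _ = _ := by simp only [Finset.sum_const, Finset.card_univ, Fintype.card_fin, nsmul_eq_mul]; push_cast; ring

/-- `Σ_c‖∂_c(J•ζ)(x)‖ ≤ 27C₁‖ζ x‖ + 9C₀Σ_c‖∂_cζ x‖`. -/
theorem sum_norm_partialDeriv_distort_le_pt (hJ : ∀ a m, Torus.IsSmooth (fun y => Jt y a m)) (hζ : Torus.IsSmooth ζ)
    {C₀ C₁ : ℝ} (hC0 : 0 ≤ C₀) (hC1 : 0 ≤ C₁) (hJ0 : ∀ y a m, |Jt y a m| ≤ C₀) (hJ1 : ∀ y a m c, |Torus.partialDeriv c (fun y => Jt y a m) y| ≤ C₁)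
    (x : UnitAddTorus (Fin 3)) :
    ∑ c, ‖Torus.partialDeriv c (Torus.distort Jt ζ) x‖ ≤ 27 * C₁ * ‖ζ x‖ + 9 * C₀ * ∑ c, ‖Torus.partialDeriv c ζ x‖ := by
  calc ∑ c, ‖Torus.partialDeriv c (Torus.distort Jt ζ) x‖ ≤ ∑ c, 9 * (C₁ * ‖ζ x‖ + C₀ * ‖Torus.partialDeriv c ζ x‖) :=
        Finset.sum_le_sum fun c _ => norm_partialDeriv_distort_le_pt hJ hζ hC0 hC1 hJ0 hJ1 c x
    _ = _ := by
        simp only [mul_add, Finset.sum_add_distrib, Finset.sum_const, Finset.card_univ, Fintype.card_fin, nsmul_eq_mul, ← Finset.mul_sum]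
        push_cast; ring

/-- `Σ_cΣ_e‖∂_e∂_c(J•ζ)(x)‖ ≤ 81C₂‖ζ x‖ + 54C₁Σ_c‖∂_cζ x‖ + 9C₀Σ_cΣ_e‖∂_e∂_cζ x‖`. -/
theorem sum_norm_partialDeriv₂_distort_le_pt (hJ : ∀ a m, Torus.IsSmooth (fun y => Jt y a m)) (hζ : Torus.IsSmooth ζ)
    {C₀ C₁ C₂ : ℝ} (hC0 : 0 ≤ C₀) (hC1 : 0 ≤ C₁) (hC2 : 0 ≤ C₂) (hJ0 : ∀ y a m, |Jt y a m| ≤ C₀)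
    (hJ1 : ∀ y a m c, |Torus.partialDeriv c (fun y => Jt y a m) y| ≤ C₁)
    (hJ2 : ∀ y a m c e, |Torus.partialDeriv e (Torus.partialDeriv c (fun y => Jt y a m)) y| ≤ C₂) (x : UnitAddTorus (Fin 3)) :
    ∑ c, ∑ e, ‖Torus.partialDeriv e (Torus.partialDeriv c (Torus.distort Jt ζ)) x‖
      ≤ 81 * C₂ * ‖ζ x‖ + 54 * C₁ * ∑ c, ‖Torus.partialDeriv c ζ x‖
        + 9 * C₀ * ∑ c, ∑ e, ‖Torus.partialDeriv e (Torus.partialDeriv c ζ) x‖ := by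
  calc ∑ c, ∑ e, ‖Torus.partialDeriv e (Torus.partialDeriv c (Torus.distort Jt ζ)) x‖
      ≤ ∑ c, ∑ e, 9 * (C₂ * ‖ζ x‖ + C₁ * (‖Torus.partialDeriv e ζ x‖ + ‖Torus.partialDeriv c ζ x‖)
          + C₀ * ‖Torus.partialDeriv e (Torus.partialDeriv c ζ) x‖) :=
        Finset.sum_le_sum fun c _ => Finset.sum_le_sum fun e _ => norm_partialDeriv₂_distort_le_pt hJ hζ hC0 hC1 hC2 hJ0 hJ1 hJ2 e c x
    _ = _ := by
        simp only [Fin.sum_univ_three]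
        ring

/-- **(S1b) Pointwise bound of the distorted generator on the corrected steady test `J•ζ`**:
`‖J'•ζ + (b·∇)(J•ζ) + 𝓛^{G,*}_{𝔸'}(J•ζ)‖(x) ≤ a₀‖ζ x‖ + a₁Σ_c‖∂_cζ x‖ + a₂Σ_cΣ_e‖∂_e∂_cζ x‖` with
`a₀ = 9CJ' + 27·Bb·C₁ + 3(27·CAC·81C₂ + 81(CAB+BAC)·27C₁)`, `a₁ = 9·Bb·C₀ + 3(27·CAC·54C₁ + 81(CAB+BAC)·9C₀)`, `a₂ = 3·27·CAC·9C₀`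
(`|G| ≤ C`, `|∂G| ≤ B`, `|𝔸'| ≤ A`, `|J| ≤ C₀`, `|∂J| ≤ C₁`, `|∂²J| ≤ C₂`, `|J'| ≤ CJ'`, `‖b‖ ≤ Bb`, all at the fixed time). -/
theorem norm_correctedGenerator_le_pt {J't : UnitAddTorus (Fin 3) → Matrix (Fin 3) (Fin 3) ℝ} {b₀ : VF}
    (hG1 : ∀ i j, Torus.IsContDiff 1 (fun y => Gs y i j)) (hJ : ∀ a m, Torus.IsSmooth (fun y => Jt y a m)) (hζ : Torus.IsSmooth ζ)
    (𝔸' : Torus.Visc4 (Fin 3)) {C B A C₀ C₁ C₂ CJ' Bb : ℝ} (hC0' : 0 ≤ C) (hB0 : 0 ≤ B) (hA0 : 0 ≤ A) (hC0 : 0 ≤ C₀) (hC1 : 0 ≤ C₁)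
    (hC2 : 0 ≤ C₂) (hCJ'0 : 0 ≤ CJ') (hBb0 : 0 ≤ Bb)
    (hC : ∀ y i j, |Gs y i j| ≤ C) (hB : ∀ y i j e', |Torus.partialDeriv e' (fun y => Gs y i j) y| ≤ B) (hA : ∀ i a j b', |𝔸' i a j b'| ≤ A)
    (hJ0 : ∀ y a m, |Jt y a m| ≤ C₀) (hJ1 : ∀ y a m c, |Torus.partialDeriv c (fun y => Jt y a m) y| ≤ C₁)
    (hJ2 : ∀ y a m c e, |Torus.partialDeriv e (Torus.partialDeriv c (fun y => Jt y a m)) y| ≤ C₂)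
    (hJ' : ∀ y a m, |J't y a m| ≤ CJ') (hb : ∀ y, ‖b₀ y‖ ≤ Bb) (x : UnitAddTorus (Fin 3)) :
    ‖Torus.distort J't ζ x + Torus.convect b₀ (Torus.distort Jt ζ) x
        + Torus.viscAdjVar (fun y => Torus.Visc4.conj (Gs y) 𝔸') (Torus.distort Jt ζ) x‖
      ≤ (9 * CJ' + 27 * Bb * C₁ + 3 * (27 * (C * A * C) * (81 * C₂) + 81 * (C * A * B + B * A * C) * (27 * C₁))) * ‖ζ x‖
        + (9 * Bb * C₀ + 3 * (27 * (C * A * C) * (54 * C₁) + 81 * (C * A * B + B * A * C) * (9 * C₀))) * ∑ c, ‖Torus.partialDeriv c ζ x‖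
        + (3 * (27 * (C * A * C) * (9 * C₀))) * ∑ c, ∑ e, ‖Torus.partialDeriv e (Torus.partialDeriv c ζ) x‖ := by
  have hΨ : Torus.IsSmooth (Torus.distort Jt ζ) := Torus.isSmooth_distort hJ hζ
  set S₀ : ℝ := ‖ζ x‖ with hS0
  set S₁ : ℝ := ∑ c, ‖Torus.partialDeriv c ζ x‖ with hS1
  set S₂ : ℝ := ∑ c, ∑ e, ‖Torus.partialDeriv e (Torus.partialDeriv c ζ) x‖ with hS2
  have hsum1 := sum_norm_partialDeriv_distort_le_pt (ζ := ζ) hJ hζ hC0 hC1 hJ0 hJ1 x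
  have hsum2 := sum_norm_partialDeriv₂_distort_le_pt (ζ := ζ) hJ hζ hC0 hC1 hC2 hJ0 hJ1 hJ2 x
  -- the three pieces
  have h1 : ‖Torus.distort J't ζ x‖ ≤ 9 * CJ' * S₀ := norm_distort_le_pt hCJ'0 hJ' x
  have h2 : ‖Torus.convect b₀ (Torus.distort Jt ζ) x‖ ≤ Bb * (27 * C₁ * S₀ + 9 * C₀ * S₁) := by
    refine (Torus.norm_convect_le b₀ (hΨ.isContDiff (by simp)) x).trans ?_
    exact mul_le_mul (hb x) hsum1 (Finset.sum_nonneg fun c _ => norm_nonneg _) hBb0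
  have h3 : ‖Torus.viscAdjVar (fun y => Torus.Visc4.conj (Gs y) 𝔸') (Torus.distort Jt ζ) x‖
      ≤ 3 * (27 * (C * A * C) * (81 * C₂ * S₀ + 54 * C₁ * S₁ + 9 * C₀ * S₂)
          + 81 * (C * A * B + B * A * C) * (27 * C₁ * S₀ + 9 * C₀ * S₁)) := by
    refine (norm_viscAdjVar_le_pt hG1 hΨ 𝔸' hC0' hB0 hA0 hC hB hA x).trans ?_
    have i1 : 27 * (C * A * C) * ∑ c, ∑ e, ‖Torus.partialDeriv e (Torus.partialDeriv c (Torus.distort Jt ζ)) x‖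
        ≤ 27 * (C * A * C) * (81 * C₂ * S₀ + 54 * C₁ * S₁ + 9 * C₀ * S₂) := mul_le_mul_of_nonneg_left hsum2 (by positivity)
    have i2 : 81 * (C * A * B + B * A * C) * ∑ c, ‖Torus.partialDeriv c (Torus.distort Jt ζ) x‖
        ≤ 81 * (C * A * B + B * A * C) * (27 * C₁ * S₀ + 9 * C₀ * S₁) := mul_le_mul_of_nonneg_left hsum1 (by positivity)
    linarith
  calc ‖Torus.distort J't ζ x + Torus.convect b₀ (Torus.distort Jt ζ) x
        + Torus.viscAdjVar (fun y => Torus.Visc4.conj (Gs y) 𝔸') (Torus.distort Jt ζ) x‖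
      ≤ ‖Torus.distort J't ζ x‖ + ‖Torus.convect b₀ (Torus.distort Jt ζ) x‖
          + ‖Torus.viscAdjVar (fun y => Torus.Visc4.conj (Gs y) 𝔸') (Torus.distort Jt ζ) x‖ := norm_add₃_le
    _ ≤ 9 * CJ' * S₀ + Bb * (27 * C₁ * S₀ + 9 * C₀ * S₁)
          + 3 * (27 * (C * A * C) * (81 * C₂ * S₀ + 54 * C₁ * S₁ + 9 * C₀ * S₂)
              + 81 * (C * A * B + B * A * C) * (27 * C₁ * S₀ + 9 * C₀ * S₁)) := add_le_add_three h1 h2 h3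
    _ = _ := by ring

end Summit.AnomalousDissipation.AnomalousDissipation.Theorems.SolenoidalFractalHomogenisation.LagrangianStep.VmodDist

end
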